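import Summits.QuantumFields.YangMills.Theorems.BalabanUVNodesN13GaugeFixingAxialLayers
import Summits.QuantumFields.YangMills.Theorems.BalabanUVNodesN13NormalisationNoGoCouplingBlindAtRecord13SepCoPHV

/-!
# BalabanUVNodes ∕ N13 — THE COUPLING-SLOPE THRESHOLD OF THE NORMALISATION: (B) at a revised record datum + endpoint existence FORCE the per-step inputs `logz`, `Efl` to grow like
# `a·log(1∕g_j)·|T^{(j)*}|` with `a ≥ d(𝔤)·(1 − 4L⁻⁴)∕(4(1 − L⁻⁴))` — just below print's slope `d(𝔤)∕4` ([I] (0.15): `log z_j ≈ d(𝔤) log g_j`); every smaller slope is REFUTED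

(Track A, DAG node N13 = [B16]; cluster K1 — K1⁹ `StabilityBRunRowsAtRecordR13SepCoPHV` = stmt-QuantumFields-27364, helper; seat `pub-ymgap-dag-n13-w3` g5; 2026-08-28; count-neutral.)
Sharpening of p636072 (`…N13NormalisationNoGoCouplingBlindAtRecord13SepCoPHV`, the slope-`0` case) by the axial-layer Gaussian bound of `…N13GaugeFixingAxialLayers` (coefficient
`(3∕2 + 1∕(2n))d(𝔤)` instead of `(7∕4)d(𝔤)`).  HYPOTHESIS SHAPE on the witness's numerics slots (one pair of constants `a, C_w ≥ 0`, `a ≤ d(𝔤)`): on every run `p` and step `j < p.K` IN THE WEAK-COUPLING REGIME `0 < g_j ≤ 1`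
(`g_j = gOfRecord₁₃ θ p j`), `−logz_p(j)·(L⁴−1)|T₁^{(j+1)}| + Efl_p(j) ≤ (a·(−log g_j) + C_w)·|T^{(j)*}|` — the inputs may depend on the couplings, but with LOG-SLOPE at most `a`.
Print's `z` of (0.15) gives `−log z_j·(L⁴−1)|T₁^{(j+1)}| ≈ d(𝔤)·log(1∕g_j)·(L⁴−1)|T₁^{(j+1)}| = (d(𝔤)∕4)·log(1∕g_j)·|T^{(j)*}|`, i.e. slope EXACTLY `d(𝔤)∕4`.

THE THEOREM (§2): if `κ := 2(1−L⁻⁴)(d(𝔤) − a) − (3∕2)d(𝔤) > 0` — equivalently `a < d(𝔤)(1−4L⁻⁴)∕(4(1−L⁻⁴))`, a hair below `d(𝔤)∕4` — then at EVERY tuple `(θ, h, v)` with slope-`a` inputs, `B16.EndStatementBPrinted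
(datumOfRecord₁₃SepCoPHV F N θ h v).C` and `DagBinding.EndpointExistence (…).C.toB12` are jointly contradictory.  ROAD: on a γ-windowed run with `K ≥ 1`, §1 gives
`E(P) ≤ −2(1−L⁻⁴)(d(𝔤)−a)|T₁^{(0)}| log β₀ + 4(|log σ₀| + C_w)|T₁^{(0)}|` (EXACT `|T^{(0)*}| = 4(1−L⁻⁴)|T₁^{(0)}|`); the axial-layer bound gives `log Z ≥ −(3∕2 + 1∕(2n))d(𝔤)|T₁^{(0)}| log β₀ − C|T₁^{(0)}|`
(`n = 2L^{m+K}`); p625602's window `log Z − E ≤ ep(g_K)(2L^m)⁴`; along END's fixed-endpoint runs with `n ≥ d(𝔤)∕κ` and `γ ≤ exp(−C'∕κ)` this reads `|T₁^{(0)}(K)| ≤ ep(g)(2L^m)⁴` — absurd for large `K`.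
So the slopes this argument EXCLUDES are `[0, d(𝔤)(1−4L⁻⁴)∕(4(1−L⁻⁴)))`; print's `d(𝔤)∕4` lies `(3∕4)d(𝔤)L⁻⁴∕(1−L⁻⁴)` ABOVE the threshold — that slack is exactly the contribution of the scales
`j ≥ 1`, which §1 drops (`(d(𝔤)−a)·log g_j ≤ 0`) and which print's `E` uses to match `log Z` to leading order; the theorem does not touch print's normalisation.  (An UPPER bound on the slope
would need a Gaussian UPPER bound on `Z`; not here.)
WHAT IS PROVED (0 `sorry`, 0 `def`): §1 `tstarCount_zero_eq` (`|T^{(0)*}| = 4(1−L⁻⁴)|T₁^{(0)}|`), `EOfRecord₁₃_le_of_logSlope`; §2 `le_sitesPerDir_zero`,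
★★★ `false_of_endStatementBPrinted_of_endpointExistence_of_logSlope`.  (p636072's coupling-blind theorem is the case `a = 0`, where `κ = (½ − 2L⁻⁴)d(𝔤) > 0` for `N ≥ 2`; not restated.)
HONEST FRAMING: count-neutral; nothing of Bałaban's asserted or refuted — the excluded classes are the TREE's numerics slots with sub-print slope; K1⁹ NEITHER proved NOR refuted; no skeleton ∕ route
text changed; N13 NOT discharged; counts UNMOVED (typed 28∕28 · discharged 5∕27 · A 5∕28); R4 closes the conditional finite-𝕋⁴ rung `BalabanLadder.UV` only — the Yang–Mills mass gap (Clay) is NOT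
proved by any of this; nothing continuum ∕ ℝ⁴ ∕ OS.  No `sorry`, `def`, `instance`, `notation`.
-/

noncomputable section

open MeasureTheory
open scoped BigOperators

namespace Summit.QuantumFields.YangMills.BalabanUVNodes.N13NormalisationSlopeThresholdAtRecord13SepCoPHV

open Literature.MathematicalPhysics.QuantumFieldTheory.Balaban1983to89
open Literature.MathematicalPhysics.QuantumFieldTheory.Balaban1983to89.T4Continuum
open Literature.MathematicalPhysics.QuantumFieldTheory.Balaban1983to89.Node00
open Literature.MathematicalPhysics.QuantumFieldTheory.Balaban1983to89.FlowStepRuns (genSeq genSeq_zero)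
open Missing
open Summit.QuantumFields.YangMills.BalabanUVNodes.N13UV01LevelZeroAtRecord13 (tstarCount_P_nonneg sum_tstarCount_P_range_le)
open Summit.QuantumFields.YangMills.BalabanUVNodes.N13GaugeFixingAxialLayers (log_partitionFn_ge_axialLayers_specialUnitary_d4)
open Summit.QuantumFields.YangMills.BalabanUVNodes.N13NormalisationWindowOfCor3AtRecord13SepCoPHV (log_partitionFn_sub_E_le_of_cor3With)
open Summit.QuantumFields.YangMills.BalabanUVNodes.N13NormalisationNoGoCouplingBlindAtRecord13SepCoPHV
  (dimSU_cast card_site_zero_eq card_site_top_pos le_L_pow)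

variable {F : T4Family} {N : ℕ} [NeZero N]

/-! ## §1. `E(P)` of a witness with coupling slope `a` along a windowed run -/

section EBound

variable (θ : Stage13Params F N) (P : B12.RunParams)

/-- **`|T^{(0)*}| = 4(1 − L⁻⁴)·|T₁^{(0)}|` EXACTLY** (`K ≥ 1`: `|T₁^{(0)}| = L⁴|T₁^{(1)}|`, `Site.card_site_eq_mul_succ`). [cite: Balaban1988Convergent, (1.15) p.249 (bookkeeping)] -/
theorem tstarCount_zero_eq (K : ℕ) (hK : 1 ≤ K) :
    tstarCount (F.P K) 0 = 4 * (1 - ((F.L : ℝ) ^ 4)⁻¹) * (Fintype.card (Site (F.P K) 0) : ℝ) := by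
  unfold tstarCount sitesCard
  have h := Site.card_site_eq_mul_succ (P := F.P K) (j := 0) (by simp; omega)
  have hL : (0 : ℝ) < (F.L : ℝ) ^ 4 := by
    have : (0 : ℝ) < F.L := by exact_mod_cast (lt_trans zero_lt_one F.hL.2)
    positivity
  have h0 : (Fintype.card (Site (F.P K) 0) : ℝ) = (F.L : ℝ) ^ 4 * (Fintype.card (Site (F.P K) (0 + 1)) : ℝ) := by
    have := congrArg (fun k : ℕ => (k : ℝ)) h
    push_cast at this
    simpa using this
  simp only [Nat.zero_add] at h0 ⊢
  rw [h0]
  have hinv : ((F.L : ℝ) ^ 4)⁻¹ * (F.L : ℝ) ^ 4 = 1 := inv_mul_cancel₀ hL.ne'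
  linear_combination (4 * (Fintype.card (Site (F.P K) 1) : ℝ)) * hinv

/-- **`E(P)` OF A SLOPE-`a` WITNESS ALONG A γ-WINDOWED RUN** (`K ≥ 1`, `0 < g_j ≤ γ ≤ 1`; `0 ≤ a ≤ d(𝔤)`, `0 ≤ C_w`): if for `j < K`
`−logz_j·(L⁴−1)|T₁^{(j+1)}| + Efl_j ≤ (a·(−log g_j) + C_w)·|T^{(j)*}|`, then `E(P) ≤ −2(1−L⁻⁴)(d(𝔤) − a)·|T₁^{(0)}|·log(g₀⁻²)∕… ` — precisely
`E(P) ≤ (d(𝔤) − a)·|T^{(0)*}|·log g₀ + 4(|log σ₀| + C_w)|T₁^{(0)}|` with `|T^{(0)*}| = 4(1−L⁻⁴)|T₁^{(0)}|` (every scale-`j ≥ 1` logarithm dropped: `(d(𝔤) − a) log g_j ≤ 0`).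
[cite: Balaban1988Convergent, (1.15) p.249, Thm 1 p.262 (the shape of `E`; bookkeeping); Balaban1987RG1, (0.15) p.254] -/
theorem EOfRecord₁₃_le_of_logSlope {a Cw : ℝ} (ha : a ≤ ((dimSU N : ℕ) : ℝ)) (hCw : 0 ≤ Cw)
    (hw : ∀ j, j < P.K → 0 < gOfRecord₁₃ F N θ P j → gOfRecord₁₃ F N θ P j ≤ 1 →
      -(θ.logz P j) * ((((F.P P.K).L : ℝ) ^ 4 - 1) * sitesCard (F.P P.K) (j + 1)) + θ.Efl P j ≤
        (a * (-Real.log (gOfRecord₁₃ F N θ P j)) + Cw) * tstarCount (F.P P.K) j)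
    (hK : 1 ≤ P.K) {γ : ℝ} (hγ : γ ≤ 1) (hI : ∀ k, k ≤ P.K → 0 < gOfRecord₁₃ F N θ P k ∧ gOfRecord₁₃ F N θ P k ≤ γ) :
    EOfRecord₁₃ F N θ P ≤ (((dimSU N : ℕ) : ℝ) - a) * (4 * (1 - ((F.L : ℝ) ^ 4)⁻¹) * (Fintype.card (Site (F.P P.K) 0) : ℝ)) * Real.log P.g0
      + 4 * (|θ.ν.logσ₀| + Cw) * (Fintype.card (Site (F.P P.K) 0) : ℝ) := by
  have hE : EOfRecord₁₃ F N θ P = ∑ j ∈ Finset.range P.K, eStepOfRecord N θ.ν (θ.Efl P) (θ.logz P) (gOfRecord₁₃ F N θ P) (F.P P.K) j := rfl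
  set d : ℝ := ((dimSU N : ℕ) : ℝ) with hd
  have hda : 0 ≤ d - a := by linarith
  have hstep : ∀ j ∈ Finset.range P.K, eStepOfRecord N θ.ν (θ.Efl P) (θ.logz P) (gOfRecord₁₃ F N θ P) (F.P P.K) j ≤
      (if j = 0 then (d - a) * tstarCount (F.P P.K) 0 * Real.log P.g0 else 0) + (|θ.ν.logσ₀| + Cw) * tstarCount (F.P P.K) j := by
    intro j hj
    have hjK : j < P.K := Finset.mem_range.mp hj
    have hg := hI j hjK.le
    have hlog : Real.log (gOfRecord₁₃ F N θ P j) ≤ 0 := Real.log_nonpos hg.1.le (hg.2.trans hγ)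
    have hT : 0 ≤ tstarCount (F.P P.K) j := tstarCount_P_nonneg (F := F) (by simp; omega)
    have hwj := hw j hjK hg.1 (hg.2.trans hγ)
    have hσ : θ.ν.logσ₀ * tstarCount (F.P P.K) j ≤ |θ.ν.logσ₀| * tstarCount (F.P P.K) j :=
      mul_le_mul_of_nonneg_right (le_abs_self _) hT
    unfold eStepOfRecord
    rw [← hd]
    by_cases hj0 : j = 0
    · subst hj0
      have hg0 : gOfRecord₁₃ F N θ P 0 = P.g0 := genSeq_zero _ _
      rw [if_pos rfl]
      rw [hg0] at hwj ⊢
      nlinarith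
    · rw [if_neg hj0]
      have hneg : (d - a) * (Real.log (gOfRecord₁₃ F N θ P j) * tstarCount (F.P P.K) j) ≤ 0 :=
        mul_nonpos_of_nonneg_of_nonpos hda (mul_nonpos_of_nonpos_of_nonneg hlog hT)
      nlinarith
  rw [hE]
  refine (Finset.sum_le_sum hstep).trans ?_
  rw [Finset.sum_add_distrib, Finset.sum_ite_eq' (Finset.range P.K) 0, if_pos (Finset.mem_range.mpr hK), ← Finset.mul_sum]
  have hsum : (|θ.ν.logσ₀| + Cw) * ∑ j ∈ Finset.range P.K, tstarCount (F.P P.K) j ≤ (|θ.ν.logσ₀| + Cw) * (4 * (Fintype.card (Site (F.P P.K) 0) : ℝ)) :=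
    mul_le_mul_of_nonneg_left (sum_tstarCount_P_range_le (F := F) P.K P.K) (by positivity)
  rw [tstarCount_zero_eq P.K hK]
  nlinarith [hsum]

end EBound

/-! ## §2. The slope threshold -/

section NoGo

variable (θ : Stage13HParams F N) (h : θ.Provisos₁₃SepCoPH F N) (v : Revision₁₃ F N θ h)

/-- `n = |T₁^{(0)}| sites per direction of the finest lattice = 2L^{m+K} ≥ K`. [cite: Balaban1987RG1, (0.1) p.251 (bookkeeping)] -/
theorem le_sitesPerDir_zero (K : ℕ) : (K : ℝ) ≤ ((F.P K).sitesPerDir 0 : ℝ) := by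
  have hL2 : 2 ≤ F.L := F.hL.2
  have h1 : K < 2 ^ K := Nat.lt_two_pow_self
  have h2 : 2 ^ K ≤ F.L ^ K := Nat.pow_le_pow_left hL2 K
  have h3 : F.L ^ K ≤ F.L ^ (F.m + K) := Nat.pow_le_pow_right (by omega) (by omega)
  have h4 : (F.P K).sitesPerDir 0 = 2 * F.L ^ (F.m + K) := by simp [Params.sitesPerDir]
  have : K ≤ (F.P K).sitesPerDir 0 := by rw [h4]; omega
  exact_mod_cast this

/-- **★★★ THE SLOPE THRESHOLD.**  Let `d = d(𝔰𝔲(N))`, `0 ≤ a ≤ d`, `0 ≤ C_w`, and suppose the witness's numerics slots have LOG-SLOPE AT MOST `a`: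
`∀ p j, j < p.K → −logz_p(j)·(L⁴−1)|T₁^{(j+1)}| + Efl_p(j) ≤ (a·(−log g_j) + C_w)·|T^{(j)*}|` (`g_j = gOfRecord₁₃ θ p j`).  If `κ := 2(1−L⁻⁴)(d − a) − (3∕2)d > 0` (i.e. `a` below
`d(1−4L⁻⁴)∕(4(1−L⁻⁴))`, just under print's `d∕4`), then (B) at the revised datum and endpoint existence are JOINTLY CONTRADICTORY.  [cite: Balaban1988Convergent, Thm 1 p.262, (1.15) p.249, Cor. 3 (2.50) p.264; Balaban1987RG1, Thm 2 p.259, (0.15) p.254] -/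
theorem false_of_endStatementBPrinted_of_endpointExistence_of_logSlope {a Cw : ℝ} (ha0 : 0 ≤ a) (ha : a ≤ ((dimSU N : ℕ) : ℝ)) (hCw : 0 ≤ Cw)
    (hκ : 0 < 2 * (1 - ((F.L : ℝ) ^ 4)⁻¹) * (((dimSU N : ℕ) : ℝ) - a) - 3 / 2 * ((dimSU N : ℕ) : ℝ))
    (hw : ∀ (p : B12.RunParams) (j : ℕ), j < p.K → 0 < gOfRecord₁₃ F N θ.toStage13Params p j → gOfRecord₁₃ F N θ.toStage13Params p j ≤ 1 →
      -(θ.logz p j) * ((((F.P p.K).L : ℝ) ^ 4 - 1) * sitesCard (F.P p.K) (j + 1)) + θ.Efl p j ≤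
        (a * (-Real.log (gOfRecord₁₃ F N θ.toStage13Params p j)) + Cw) * tstarCount (F.P p.K) j)
    (hB : B16.EndStatementBPrinted (datumOfRecord₁₃SepCoPHV F N θ h v).C)
    (hE : DagBinding.EndpointExistence (datumOfRecord₁₃SepCoPHV F N θ h v).C.toB12) : False := by
  obtain ⟨-, γB, hγB, em, ep, hcor⟩ := hB
  obtain ⟨γ₂, hγ₂, hend⟩ := hE F.m
  -- constants; `d > 0` from `κ > 0`, `0 ≤ a ≤ d`
  have hεnn : 0 ≤ ((F.L : ℝ) ^ 4)⁻¹ := by positivity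
  have hdpos : 0 < ((dimSU N : ℕ) : ℝ) := by
    have h1 : 0 ≤ ((F.L : ℝ) ^ 4)⁻¹ * (((dimSU N : ℕ) : ℝ) - a) := mul_nonneg hεnn (sub_nonneg.2 ha)
    nlinarith [hκ, h1, ha0]
  set d : ℝ := ((dimSU N : ℕ) : ℝ) with hddef
  set κ : ℝ := 2 * (1 - ((F.L : ℝ) ^ 4)⁻¹) * (d - a) - 3 / 2 * d with hκdef
  set CN : ℝ := ((N * N : ℕ) : ℝ) * Real.log (16 * Real.pi + 1) + Real.log ((2 * N + 1) / (4 * Real.pi)) with hCN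
  set C : ℝ := 4 * |CN| + 128 + 4 * (|θ.ν.logσ₀| + Cw) + 1 with hCdef
  have hCpos : 0 < C := by positivity
  -- the window γ
  set γ : ℝ := min (min γB γ₂) (min 1 (Real.exp (-(C / κ)))) with hγdef
  have hγpos : 0 < γ := lt_min (lt_min hγB hγ₂) (lt_min one_pos (Real.exp_pos _))
  have hγB' : γ ≤ γB := (min_le_left _ _).trans (min_le_left _ _)
  have hγ₂' : γ ≤ γ₂ := (min_le_left _ _).trans (min_le_right _ _)
  have hγ1 : γ ≤ 1 := (min_le_right _ _).trans (min_le_left _ _)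
  have hγexp : γ ≤ Real.exp (-(C / κ)) := (min_le_right _ _).trans (min_le_right _ _)
  obtain ⟨g, hgpos, hruns⟩ := hend γ hγpos hγ₂'
  have hrun : ∀ K : ℕ, ∃ g0 : ℝ, ((datumOfRecord₁₃SepCoPHV F N θ h v).C ⟨K, F.m, g0⟩).flow.InInterval γ K ∧
      ((datumOfRecord₁₃SepCoPHV F N θ h v).C ⟨K, F.m, g0⟩).flow.g K = g := fun K => by
    obtain ⟨g0, h1, h2⟩ := hruns g hgpos le_rfl K
    exact ⟨g0, h1, h2⟩
  -- per-`K` inequality, for `K ≥ 1` with `n_K ≥ d/κ`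
  have hkey : ∀ K : ℕ, 1 ≤ K → d / κ ≤ ((F.P K).sitesPerDir 0 : ℝ) →
      (Fintype.card (Site (F.P K) 0) : ℝ) ≤ ep g * (Fintype.card (Site (F.P K) K) : ℝ) := by
    intro K hK hnK
    obtain ⟨g0, hI, hgK⟩ := hrun K
    have hwin := log_partitionFn_sub_E_le_of_cor3With F N θ h v hcor K g0 (fun k hk => ⟨(hI k hk).1, (hI k hk).2.trans hγB'⟩)
    have hnum : ((datumOfRecord₁₃SepCoPHV F N θ h v).C ⟨K, F.m, g0⟩).numSites K = Fintype.card (Site (F.P K) K) := rfl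
    rw [hgK, hnum] at hwin
    have hflow : ((datumOfRecord₁₃SepCoPHV F N θ h v).C ⟨K, F.m, g0⟩).flow.g = gOfRecord₁₃ F N θ.toStage13Params ⟨K, F.m, g0⟩ :=
      flow_g_datumOfRecord₁₃SepCoPHV F N θ h v ⟨K, F.m, g0⟩
    have hI' : ∀ k, k ≤ K → 0 < gOfRecord₁₃ F N θ.toStage13Params ⟨K, F.m, g0⟩ k ∧ gOfRecord₁₃ F N θ.toStage13Params ⟨K, F.m, g0⟩ k ≤ γ :=
      fun k hk => by have := hI k hk; rwa [hflow] at this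
    have hg0 : 0 < g0 ∧ g0 ≤ γ := by
      have := hI' 0 (Nat.zero_le _)
      rwa [show gOfRecord₁₃ F N θ.toStage13Params ⟨K, F.m, g0⟩ 0 = g0 from genSeq_zero _ _] at this
    -- §1: `E` above
    have hEle := EOfRecord₁₃_le_of_logSlope (F := F) θ.toStage13Params ⟨K, F.m, g0⟩ ha hCw (fun j hj h0 h1 => hw ⟨K, F.m, g0⟩ j hj h0 h1) hK hγ1 hI'
    dsimp only at hEle
    -- the axial-layer bound at `β₀ = g₀⁻² ≥ 1`
    have hβ : 1 ≤ g0⁻¹ ^ 2 := by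
      have h1 : 1 ≤ g0⁻¹ := (one_le_inv₀ hg0.1).2 (hg0.2.trans hγ1)
      nlinarith
    have hZ := log_partitionFn_ge_axialLayers_specialUnitary_d4 N (F.P K) (T4Family.P_d F K) hβ
    rw [← dimSU_cast (N := N)] at hZ
    rw [← hddef] at hEle hZ
    rw [← hCN] at hZ
    have hlogβ : Real.log (g0⁻¹ ^ 2) = -2 * Real.log g0 := by rw [Real.log_pow, Real.log_inv]; ring
    rw [hlogβ] at hZ
    have hlogg0 : Real.log g0 ≤ -(C / κ) := by
      have h1 : Real.log g0 ≤ Real.log γ := Real.log_le_log hg0.1 hg0.2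
      have h2 : Real.log γ ≤ -(C / κ) := by
        have := Real.log_le_log hγpos hγexp
        rwa [Real.log_exp] at this
      linarith
    -- atoms
    set T0 : ℝ := (Fintype.card (Site (F.P K) 0) : ℝ) with hT0
    set nK : ℝ := (Fintype.card (Site (F.P K) K) : ℝ) with hnK
    set n : ℝ := ((F.P K).sitesPerDir 0 : ℝ) with hn
    set X : ℝ := Real.log g0 with hX
    set ε : ℝ := ((F.L : ℝ) ^ 4)⁻¹ with hε
    have hT0nn : 0 ≤ T0 := Nat.cast_nonneg _
    have hn1 : (1 : ℝ) ≤ n := by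
      have h1 : 1 ≤ (F.P K).sitesPerDir 0 := Nat.pos_of_ne_zero ((F.P K).sitesPerDir_ne_zero 0)
      have h2 : (1 : ℝ) ≤ ((F.P K).sitesPerDir 0 : ℝ) := by exact_mod_cast h1
      rw [hn]; exact h2
    have hnpos : 0 < n := lt_of_lt_of_le one_pos hn1
    have hninv1 : n⁻¹ ≤ 1 := inv_le_one_of_one_le₀ hn1
    have hninv0 : 0 ≤ n⁻¹ := inv_nonneg.2 hnpos.le
    -- `log Z ≤ E + ep g·nK`, and the two bounds
    have h1 : Real.log (partitionFn (G := SU N) (F.P K) (g0⁻¹ ^ 2)) ≤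
        (d - a) * (4 * (1 - ε) * T0) * X + 4 * (|θ.ν.logσ₀| + Cw) * T0 + ep g * nK := by linarith [hwin, hEle]
    have hcomb : -((3 + n⁻¹) * T0) * (d / 2 * (-2 * X) + CN) - 128 * T0 ≤
        (d - a) * (4 * (1 - ε) * T0) * X + 4 * (|θ.ν.logσ₀| + Cw) * T0 + ep g * nK := le_trans hZ h1
    -- pass to `V = T0·(−X) ≥ 0`
    have hXle : X ≤ -(C / κ) := hlogg0
    have hXnn : 0 ≤ -X := by
      have : 0 < C / κ := div_pos hCpos hκ
      linarith
    have e1 : -((3 + n⁻¹) * T0) * (d / 2 * (-2 * X) + CN) - 128 * T0 =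
        -((3 + n⁻¹) * d) * (T0 * -X) - (3 + n⁻¹) * T0 * CN - 128 * T0 := by ring
    have e2 : (d - a) * (4 * (1 - ε) * T0) * X = -(4 * (1 - ε) * (d - a)) * (T0 * -X) := by ring
    rw [e1, e2] at hcomb
    set V : ℝ := T0 * -X with hV
    have hVnn : 0 ≤ V := mul_nonneg hT0nn hXnn
    -- `(3 + 1/n)·T0·CN ≤ 4|CN|·T0`
    have habs : (3 + n⁻¹) * T0 * CN ≤ 4 * |CN| * T0 := by
      have h3 : (3 + n⁻¹) * T0 * CN ≤ (3 + n⁻¹) * T0 * |CN| := mul_le_mul_of_nonneg_left (le_abs_self CN) (by positivity)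
      have h4 : 0 ≤ (1 - n⁻¹) * (T0 * |CN|) := mul_nonneg (sub_nonneg.2 hninv1) (mul_nonneg hT0nn (abs_nonneg CN))
      linarith [h3, h4]
    -- `d/n ≤ κ`
    have hκn : d * n⁻¹ ≤ κ := by
      have := (div_le_iff₀ hκ).1 hnK
      rw [← div_eq_mul_inv]
      exact (div_le_iff₀ hnpos).2 (by linarith)
    -- `κ·V ≥ C·T0`
    have hκV : C * T0 ≤ κ * V := by
      have h5 : C / κ ≤ -X := by linarith
      have h6 : κ * (C / κ) ≤ κ * -X := mul_le_mul_of_nonneg_left h5 hκ.le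
      rw [mul_div_cancel₀ _ hκ.ne'] at h6
      have h7 : C * T0 ≤ κ * -X * T0 := mul_le_mul_of_nonneg_right h6 hT0nn
      rw [hV]; linarith
    -- combine: `(2κ − d/n)·V ≤ (C−1)·T0 + ep g·nK`, `κ·V ≤ (2κ − d/n)·V`
    have hκdef' : 4 * (1 - ε) * (d - a) - 3 * d = 2 * κ := by rw [hκdef]; ring
    have hmono : κ * V ≤ (4 * (1 - ε) * (d - a) - (3 + n⁻¹) * d) * V := by
      have : κ ≤ 4 * (1 - ε) * (d - a) - (3 + n⁻¹) * d := by linarith [hκn, hκdef']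
      exact mul_le_mul_of_nonneg_right this hVnn
    rw [hCdef] at hκV
    linarith [hcomb, habs, hκV, hmono]
  -- choose `K ≥ max(⌈ep g⌉ + 1, ⌈d/κ⌉)`: the volume grows like `L^{4K}`, the side like `2L^{m+K} ≥ K`
  obtain ⟨K, hK1, hKbig, hKn⟩ : ∃ K : ℕ, 1 ≤ K ∧ ep g < (K : ℝ) ∧ d / κ ≤ (K : ℝ) := by
    set K₀ : ℕ := max (⌈ep g⌉₊ + 1) ⌈d / κ⌉₊ with hK₀
    have hA : ⌈ep g⌉₊ + 1 ≤ K₀ := le_max_left _ _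
    have hB' : ⌈d / κ⌉₊ ≤ K₀ := le_max_right _ _
    have hA' : (⌈ep g⌉₊ : ℝ) + 1 ≤ (K₀ : ℝ) := by exact_mod_cast hA
    have hB'' : (⌈d / κ⌉₊ : ℝ) ≤ (K₀ : ℝ) := by exact_mod_cast hB'
    refine ⟨K₀, le_trans (by omega) hA, ?_, ?_⟩
    · have h1 := Nat.le_ceil (ep g)
      linarith
    · have h1 := Nat.le_ceil (d / κ)
      linarith
  have h1 := hkey K hK1 (le_trans hKn (le_sitesPerDir_zero (F := F) K))
  rw [card_site_zero_eq (F := F) K] at h1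
  have hn := card_site_top_pos (F := F) K
  have hL := le_L_pow (F := F) K
  have : (Fintype.card (Site (F.P K) K) : ℝ) * ((F.L : ℝ) ^ K) ^ 4 < (Fintype.card (Site (F.P K) K) : ℝ) * ((F.L : ℝ) ^ K) ^ 4 :=
    calc (Fintype.card (Site (F.P K) K) : ℝ) * ((F.L : ℝ) ^ K) ^ 4 ≤ ep g * (Fintype.card (Site (F.P K) K) : ℝ) := h1
      _ < (K : ℝ) * (Fintype.card (Site (F.P K) K) : ℝ) := mul_lt_mul_of_pos_right hKbig hn
      _ ≤ ((F.L : ℝ) ^ K) ^ 4 * (Fintype.card (Site (F.P K) K) : ℝ) := mul_le_mul_of_nonneg_right hL hn.le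
      _ = (Fintype.card (Site (F.P K) K) : ℝ) * ((F.L : ℝ) ^ K) ^ 4 := mul_comm _ _
  exact lt_irrefl _ this

end NoGo

end Summit.QuantumFields.YangMills.BalabanUVNodes.N13NormalisationSlopeThresholdAtRecord13SepCoPHV

end
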